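import Literature.Analysis.Asymptotics.LinearRecurrenceQuadraticSource
import Literature.Probability.RandomPlanarGeometry.HexSAWStripWidthTwoHatContactAnnihilator
import Literature.Probability.RandomPlanarGeometry.HexSAWStripWidthTwoContactAsymptotics
import HarnessLib

/-!
# The width-two strip at criticality, by the det route: the contact hat sums `Ĉ`, `Ĉ²` of `S₂` have LINEAR / QUADRATIC laws with forced leading
# coefficients `cA`, `c²A`, `c = −T_y/T_λ = ½ + x_c²`, and the source data of the cubic law (module «WIDTH-TWO CONTACT MOMENT LAWS»)

Topic `Literature/Probability/RandomPlanarGeometry` (continues «WIDTH-TWO HAT CONTACT ANNIHILATOR» — `W2.detYTwo`, `W2.detYTwoDot`, `W2.hatC3DTwo`, the three contact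
annihilators —, «WIDTH-TWO HAT CONVERGENCE» / «WIDTH-TWO CONTACT ASYMPTOTICS» (`W2.limTwo`, `W2.pTwo`, `W2.kTwo`, `W2.rhoTwo`, `W2.exists_gTwo_pow_mul_sub_abs_le`,
`W2.hatD_two_eq_pow_mul`, `W2.projTwo_mul_one_add`) and the model-free «LINEAR RECURRENCE WITH POLYNOMIAL / QUADRATIC SOURCE»
(`Literature.Analysis.exists_abs_sub_quadratic_le_of_linearRecurrence_one_real`, `…cubic…`)).  Lane «pcv-sawmu» (CriticalPhenomena venture), a-p2 g29 — the width-TWO run of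
the det-P device built for `T = 3` («WIDTH-THREE CONTACT ASYMPTOTICS» / «THIRD CONTACT MOMENT»): the annihilating polynomial at `y₂` factors as `λ(λ − 1)(λ² + pλ + κ)`
with the tree's `p = pTwo`, `κ = kTwo` (roots `0` and a complex pair of modulus `√κ = 0.2766`), so `Q = X³ + pX² + κX` (monic, roots in `‖z‖ < 3/5` by the dominance
certificate).  The scalars of `T(λ; y) = Σ t_r(y)λ^r` at `(1, y₂)` are tiny elements of `ℚ(x_c²)`: `T_λ = 8/7 − 6x²/7`, `T_λλ = 6 − 2x²`, `T_λλλ = 120/7 − 6x²/7`,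
`T_y = x² − 1`, `T_λy = −20/7 + 15x²/7`, `Σr²ṫ = −62/7 + 43x²/7` (and `(y∂_y)^jT = T_y`-type scalars repeat since `t_r` is linear in `y`).  Frame: W. Feller I (1968)
XIII.6; nothing below is printed.

## What is proved (namespace `…SAW.HV.W2`; `y₂ = stripYT 2`, `A = limTwo a b`, `R = rTwoDet = max(3/5, ρ₂)`)
* §1 the scalars `tOneTwo … trryTwo` and their closed forms; `stripYT_two_crit_det` (`1 − x²(1+y₂) + x⁴y₂ − x⁶y₂ = 0`); `detYTwo_three/two/one_eq` (`t₃ = p − 1`, `t₂ = κ − p`, `t₁ = −κ`).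
* §2 `qMonicTwo = X³ + pX² + κX`: `qMonicTwo_monic`, `qMonicTwo_coeff`, ★ `qMonicTwo_root_norm_le` (`‖z‖ ≤ 3/5`), `sum_coeff_qMonicTwo` (`= T_λ`), `sum_coeff_mul_qMonicTwo`
  (`= T_λλ/2`), `sum_coeff_sq_qMonicTwo` (`= T_λλλ/3 + T_λλ/2`), `sum_coeff_qMonicTwo_diff` (the recurrence conversion); `rTwoDet`, `abs_hatD_two_sub_lim_le`.
* §3 `cDetTwo = −T_y/T_λ`, `linQTwoDet`, `cubSrc·TwoDet`, `cubA/B/CTwoDet`.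
* §4 ★★★ `exists_hatCD_two_linear_det`, `exists_hatC2D_two_quadratic_det` — the first two moment laws with geometric errors `K(n+1)^{3,6}Rⁿ` (the cubic law of `Ĉ³`
  and the skewness are the next module «WIDTH-TWO CONTACT SKEWNESS»).

Label: LANE THEOREM (own result of lane «pcv-sawmu», a-p2 g29, 2026-08-28; not in print).  NOT claimed here: the skewness law and `κ₃(T=2) = (13836 − 9785√2)/16` (next module).
-/

noncomputable section

open Finset Filter Topology Matrix Polynomial Literature.Probability.LatticeModels Literature.Probability.Percolation

namespace Literature.Probability.RandomPlanarGeometry.SAW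

namespace HV

namespace W2

/-! ## §1 The scalars of `det(λ − G₂(y))` at `(1, y₂)` -/

/-- `T_λ := Σ_r r·t_r(y₂)`. [cite: Stanley2012EC1, §4.1 Theorem 4.1.1; lane «pcv-sawmu» a-p2 g29] -/
def tOneTwo : ℝ := ∑ r ∈ range 5, (r : ℝ) * detYTwo (stripYT 2) r
/-- `T_λλ := Σ_r r(r−1)·t_r(y₂)`. [cite: Stanley2012EC1, §4.1 Theorem 4.1.1; lane «pcv-sawmu» a-p2 g29] -/
def tTwoTwo : ℝ := ∑ r ∈ range 5, (r : ℝ) * ((r : ℝ) - 1) * detYTwo (stripYT 2) r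
/-- `T_λλλ := Σ_r r(r−1)(r−2)·t_r(y₂)`. [cite: Stanley2012EC1, §4.1 Theorem 4.1.1; lane «pcv-sawmu» a-p2 g29] -/
def tThreeTwo : ℝ := ∑ r ∈ range 5, (r : ℝ) * ((r : ℝ) - 1) * ((r : ℝ) - 2) * detYTwo (stripYT 2) r
/-- `T_y := Σ_r ṫ_r(y₂)` (`= y∂_y det` at `(1,y₂)`; also `= (y∂_y)²det = (y∂_y)³det` there). [cite: Feller1968, XIII.6; lane «pcv-sawmu» a-p2 g29] -/
def tyTwo : ℝ := ∑ r ∈ range 5, detYTwoDot (stripYT 2) r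
/-- `T_λy := Σ_r r·ṫ_r(y₂)`. [cite: Feller1968, XIII.6; lane «pcv-sawmu» a-p2 g29] -/
def tlyTwo : ℝ := ∑ r ∈ range 5, (r : ℝ) * detYTwoDot (stripYT 2) r
/-- `Σ_r r²·ṫ_r(y₂)`. [cite: Feller1968, XIII.6; lane «pcv-sawmu» a-p2 g29] -/
def trryTwo : ℝ := ∑ r ∈ range 5, (r : ℝ) ^ 2 * detYTwoDot (stripYT 2) r

/-- ★ **Criticality of `y₂` in det form**: `1 − x²(1 + y₂) + x⁴y₂ − x⁶y₂ = 0`, i.e. `det(1 − G₂(y₂)) = 0` (from `y₂ = (10 + 8√2)/7`, `√2 = 2 − 2x²`, `2x⁴ − 4x² + 1 = 0`).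
[cite: BeatonGuttmannJensen2012, §2; lane «pcv-sawmu» a-p2 g29] -/
theorem stripYT_two_crit_det : 1 - hexCriticalFugacity ^ 2 * (1 + stripYT 2) + hexCriticalFugacity ^ 4 * stripYT 2 - hexCriticalFugacity ^ 6 * stripYT 2 = 0 := by
  rw [stripYT_two, sqrt_two_eq]
  linear_combination ((8/7 : ℝ) * hexCriticalFugacity ^ 4 + (-5/7 : ℝ) * hexCriticalFugacity ^ 2 + 1) * xc_minpoly

/-- `T_λ` in closed form: `tOneTwo = (8/7 : ℝ) + (-6/7 : ℝ) * hexCriticalFugacity ^ 2` (reduction by `y₂ = (10+8√2)/7`, `√2 = 2 − 2x²`, `2x⁴ − 4x² + 1 = 0`).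
[cite: Stanley2012EC1, §4.1 Theorem 4.1.1; lane «pcv-sawmu» a-p2 g29 — own computation] -/
theorem tOneTwo_eq : tOneTwo = (8/7 : ℝ) + (-6/7 : ℝ) * hexCriticalFugacity ^ 2 := by
  simp only [tOneTwo, Finset.sum_range_succ, Finset.sum_range_zero, detYTwo, stripYT_two, sqrt_two_eq]
  push_cast
  linear_combination ((20/7 : ℝ) + (-13/7 : ℝ) * hexCriticalFugacity ^ 2 + (8/7 : ℝ) * hexCriticalFugacity ^ 4) * xc_minpoly

/-- `T_λλ` in closed form: `tTwoTwo = (6 : ℝ) + (-2 : ℝ) * hexCriticalFugacity ^ 2` (reduction by `y₂ = (10+8√2)/7`, `√2 = 2 − 2x²`, `2x⁴ − 4x² + 1 = 0`).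
[cite: Stanley2012EC1, §4.1 Theorem 4.1.1; lane «pcv-sawmu» a-p2 g29 — own computation] -/
theorem tTwoTwo_eq : tTwoTwo = (6 : ℝ) + (-2 : ℝ) * hexCriticalFugacity ^ 2 := by
  simp only [tTwoTwo, Finset.sum_range_succ, Finset.sum_range_zero, detYTwo, stripYT_two, sqrt_two_eq]
  push_cast
  linear_combination ((6 : ℝ) + (-16/7 : ℝ) * hexCriticalFugacity ^ 2) * xc_minpoly

/-- `T_λλλ` in closed form: `tThreeTwo = (120/7 : ℝ) + (-6/7 : ℝ) * hexCriticalFugacity ^ 2` (reduction by `y₂ = (10+8√2)/7`, `√2 = 2 − 2x²`, `2x⁴ − 4x² + 1 = 0`).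
[cite: Stanley2012EC1, §4.1 Theorem 4.1.1; lane «pcv-sawmu» a-p2 g29 — own computation] -/
theorem tThreeTwo_eq : tThreeTwo = (120/7 : ℝ) + (-6/7 : ℝ) * hexCriticalFugacity ^ 2 := by
  simp only [tThreeTwo, Finset.sum_range_succ, Finset.sum_range_zero, detYTwo, stripYT_two, sqrt_two_eq]
  push_cast
  linear_combination ((48/7 : ℝ)) * xc_minpoly

/-- `T_y` in closed form: `tyTwo = (-1 : ℝ) + (1 : ℝ) * hexCriticalFugacity ^ 2` (reduction by `y₂ = (10+8√2)/7`, `√2 = 2 − 2x²`, `2x⁴ − 4x² + 1 = 0`).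
[cite: Stanley2012EC1, §4.1 Theorem 4.1.1; lane «pcv-sawmu» a-p2 g29 — own computation] -/
theorem tyTwo_eq : tyTwo = (-1 : ℝ) + (1 : ℝ) * hexCriticalFugacity ^ 2 := by
  simp only [tyTwo, Finset.sum_range_succ, Finset.sum_range_zero, detYTwoDot, stripYT_two, sqrt_two_eq]
  linear_combination ((1 : ℝ) + (-5/7 : ℝ) * hexCriticalFugacity ^ 2 + (8/7 : ℝ) * hexCriticalFugacity ^ 4) * xc_minpoly

/-- `T_λy` in closed form: `tlyTwo = (-20/7 : ℝ) + (15/7 : ℝ) * hexCriticalFugacity ^ 2` (reduction by `y₂ = (10+8√2)/7`, `√2 = 2 − 2x²`, `2x⁴ − 4x² + 1 = 0`).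
[cite: Stanley2012EC1, §4.1 Theorem 4.1.1; lane «pcv-sawmu» a-p2 g29 — own computation] -/
theorem tlyTwo_eq : tlyTwo = (-20/7 : ℝ) + (15/7 : ℝ) * hexCriticalFugacity ^ 2 := by
  simp only [tlyTwo, Finset.sum_range_succ, Finset.sum_range_zero, detYTwoDot, stripYT_two, sqrt_two_eq]
  push_cast
  linear_combination ((20/7 : ℝ) + (-13/7 : ℝ) * hexCriticalFugacity ^ 2 + (8/7 : ℝ) * hexCriticalFugacity ^ 4) * xc_minpoly

/-- `Σr²ṫ` in closed form: `trryTwo = (-62/7 : ℝ) + (43/7 : ℝ) * hexCriticalFugacity ^ 2` (reduction by `y₂ = (10+8√2)/7`, `√2 = 2 − 2x²`, `2x⁴ − 4x² + 1 = 0`).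
[cite: Stanley2012EC1, §4.1 Theorem 4.1.1; lane «pcv-sawmu» a-p2 g29 — own computation] -/
theorem trryTwo_eq : trryTwo = (-62/7 : ℝ) + (43/7 : ℝ) * hexCriticalFugacity ^ 2 := by
  simp only [trryTwo, Finset.sum_range_succ, Finset.sum_range_zero, detYTwoDot, stripYT_two, sqrt_two_eq]
  push_cast
  linear_combination ((62/7 : ℝ) + (-29/7 : ℝ) * hexCriticalFugacity ^ 2 + (8/7 : ℝ) * hexCriticalFugacity ^ 4) * xc_minpoly

/-- The coefficient relations at criticality: `t₃(y₂) = p − 1`, `t₂(y₂) = κ − p`, `t₁(y₂) = −κ` with the tree's `p = pTwo`, `κ = kTwo` — i.e.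
`det(λ − G₂(y₂)) = λ(λ − 1)(λ² + pλ + κ)`. [cite: Stanley2012EC1, §4.1 Theorem 4.1.1; lane «pcv-sawmu» a-p2 g26/g29] -/
theorem detYTwo_crit_coeffs :
    detYTwo (stripYT 2) 3 = pTwo - 1 ∧ detYTwo (stripYT 2) 2 = kTwo - pTwo ∧ detYTwo (stripYT 2) 1 = -kTwo := by
  refine ⟨?_, ?_, ?_⟩ <;> simp only [detYTwo, pTwo, kTwo, stripYT_two, sqrt_two_eq]
  · linear_combination ((8/7 : ℝ)) * xc_minpoly
  · linear_combination ((-3/7 : ℝ) + (-8/7 : ℝ) * hexCriticalFugacity ^ 2) * xc_minpoly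
  · linear_combination ((2/7 : ℝ) + (3/7 : ℝ) * hexCriticalFugacity ^ 2 + (8/7 : ℝ) * hexCriticalFugacity ^ 4) * xc_minpoly

/-! ## §2 The monic factor `Q = X³ + pX² + κX`, its roots, coefficient sums, and the hat-sum convergence rate -/

/-- `Q(X) := X³ + pX² + κX` (`p = pTwo`, `κ = kTwo`): `det(λ − G₂(y₂)) = (λ − 1)·Q(λ)`. [cite: Stanley2012EC1, §4.1 Theorem 4.1.1; lane «pcv-sawmu» a-p2 g29] -/
def qMonicTwo : ℂ[X] := X ^ 3 + C ((pTwo : ℝ) : ℂ) * X ^ 2 + C ((kTwo : ℝ) : ℂ) * X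

/-- `Q` is monic of degree `3` (plumbing). [cite: Stanley2012EC1, §4.1; lane plumbing] -/
theorem qMonicTwo_monic : qMonicTwo.Monic ∧ qMonicTwo.natDegree = 3 := by
  have hdeg : (C ((pTwo : ℝ) : ℂ) * X ^ 2 + C ((kTwo : ℝ) : ℂ) * X).degree < 3 := by
    refine lt_of_le_of_lt (degree_add_le _ _) (max_lt ?_ ?_)
    · exact lt_of_le_of_lt (degree_C_mul_X_pow_le 2 _) (by exact_mod_cast (by norm_num : (2 : ℕ) < 3))
    · exact lt_of_le_of_lt (degree_C_mul_X_le _) (by exact_mod_cast (by norm_num : (1 : ℕ) < 3))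
  have e : qMonicTwo = X ^ 3 + (C ((pTwo : ℝ) : ℂ) * X ^ 2 + C ((kTwo : ℝ) : ℂ) * X) := by rw [qMonicTwo]; ring
  refine ⟨by rw [e]; exact monic_X_pow_add hdeg, ?_⟩
  rw [e, natDegree_add_eq_left_of_degree_lt (by rw [degree_X_pow]; exact hdeg), natDegree_X_pow]

/-- The coefficients of `Q`: `Q₀ = 0`, `Q₁ = κ`, `Q₂ = p`, `Q₃ = 1` (plumbing). [cite: Stanley2012EC1, §4.1; lane plumbing] -/
theorem qMonicTwo_coeff : qMonicTwo.coeff 0 = 0 ∧ qMonicTwo.coeff 1 = ((kTwo : ℝ) : ℂ) ∧ qMonicTwo.coeff 2 = ((pTwo : ℝ) : ℂ) ∧ qMonicTwo.coeff 3 = 1 := by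
  refine ⟨?_, ?_, ?_, ?_⟩ <;> simp [qMonicTwo, coeff_X_pow, coeff_C_mul, coeff_X]

/-- Numerical windows: `−0.19 < p < −0.18`, `0.07 < κ < 0.08` (from `0.29 < x² < 0.30`; plumbing). [cite: Stanley2012EC1, §4.1; lane plumbing] -/
theorem pTwo_kTwo_window : -0.19 < pTwo ∧ pTwo < -0.18 ∧ 0.07 < kTwo ∧ kTwo < 0.08 := by
  obtain ⟨h1, h2⟩ := xc_sq_bounds
  have hp : pTwo = -1 / 7 - hexCriticalFugacity ^ 2 / 7 := rfl
  have hk : kTwo = 2 / 7 - 5 * hexCriticalFugacity ^ 2 / 7 := rfl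
  refine ⟨?_, ?_, ?_, ?_⟩
  · rw [hp]; linarith
  · rw [hp]; linarith
  · rw [hk]; linarith
  · rw [hk]; linarith

/-- ★ **Every root of `Q` has modulus `≤ 3/5`** (dominance certificate `|κ|·(3/5) + |p|·(3/5)² < (3/5)³`; the nonzero roots have modulus `√κ = 0.2766`).
[cite: Stanley2012EC1, §4.1 Theorem 4.1.1 (iii); lane «pcv-sawmu» a-p2 g29] -/
theorem qMonicTwo_root_norm_le {z : ℂ} (hz : qMonicTwo.IsRoot z) : ‖z‖ ≤ 3 / 5 := by
  obtain ⟨hp1, hp2, hk1, hk2⟩ := pTwo_kTwo_window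
  obtain ⟨h0, h1, h2, h3⟩ := qMonicTwo_coeff
  have hdom : ∑ j ∈ range 3, ‖qMonicTwo.coeff j‖ * (3 / 5 : ℝ) ^ j < ‖qMonicTwo.coeff 3‖ * (3 / 5 : ℝ) ^ 3 := by
    simp only [Finset.sum_range_succ, Finset.sum_range_zero, h0, h1, h2, h3, norm_zero, zero_mul, zero_add, norm_one, one_mul,
      Complex.norm_real, Real.norm_eq_abs]
    rw [abs_of_pos (by linarith), abs_of_neg (by linarith)]
    nlinarith
  exact (Literature.Analysis.norm_lt_of_isRoot_of_dominant qMonicTwo_monic.2 (by norm_num) hdom hz).le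

/-- `Σ_j Q_j = 1 + p + κ = T_λ` (uses criticality). [cite: Stanley2012EC1, §4.1; lane plumbing] -/
theorem sum_coeff_qMonicTwo : ∑ j ∈ range (qMonicTwo.natDegree + 1), qMonicTwo.coeff j = ((tOneTwo : ℝ) : ℂ) := by
  obtain ⟨h0, h1, h2, h3⟩ := qMonicTwo_coeff
  rw [qMonicTwo_monic.2]
  simp only [Finset.sum_range_succ, Finset.sum_range_zero, h0, h1, h2, h3, zero_add, tOneTwo_eq, pTwo, kTwo]
  push_cast
  linear_combination (0 : ℂ) * h0

/-- `Σ_j j·Q_j = κ + 2p + 3 = T_λλ/2`. [cite: Stanley2012EC1, §4.1; lane plumbing] -/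
theorem sum_coeff_mul_qMonicTwo : ∑ j ∈ range (qMonicTwo.natDegree + 1), qMonicTwo.coeff j * (j : ℂ) = ((tTwoTwo / 2 : ℝ) : ℂ) := by
  obtain ⟨h0, h1, h2, h3⟩ := qMonicTwo_coeff
  rw [qMonicTwo_monic.2]
  simp only [Finset.sum_range_succ, Finset.sum_range_zero, h0, h1, h2, h3, zero_add, tTwoTwo_eq, pTwo, kTwo]
  push_cast
  ring

/-- `Σ_j j²·Q_j = κ + 4p + 9 = T_λλλ/3 + T_λλ/2`. [cite: Stanley2012EC1, §4.1; lane plumbing] -/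
theorem sum_coeff_sq_qMonicTwo : ∑ j ∈ range (qMonicTwo.natDegree + 1), qMonicTwo.coeff j * (j : ℂ) ^ 2 = ((tThreeTwo / 3 + tTwoTwo / 2 : ℝ) : ℂ) := by
  obtain ⟨h0, h1, h2, h3⟩ := qMonicTwo_coeff
  rw [qMonicTwo_monic.2]
  simp only [Finset.sum_range_succ, Finset.sum_range_zero, h0, h1, h2, h3, zero_add, tThreeTwo_eq, tTwoTwo_eq, pTwo, kTwo]
  push_cast
  ring

/-- The recurrence conversion: `Σ_{j<4} Q_j·(w_{n+1+j} − w_{n+j}) = Σ_{r<5} t_r(y₂)·w_{n+r}` for a real sequence (`(X−1)Q = det(λ − G₂(y₂))` coefficientwise, by criticality).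
[cite: Stanley2012EC1, §4.1 Theorem 4.1.1; lane plumbing] -/
theorem sum_coeff_qMonicTwo_diff (w : ℕ → ℝ) (n : ℕ) :
    ∑ j ∈ range (qMonicTwo.natDegree + 1), qMonicTwo.coeff j * (((w (n + 1 + j) : ℝ) : ℂ) - ((w (n + j) : ℝ) : ℂ))
      = ((∑ r ∈ range 5, detYTwo (stripYT 2) r * w (n + r) : ℝ) : ℂ) := by
  obtain ⟨h0, h1, h2, h3⟩ := qMonicTwo_coeff
  obtain ⟨e3, e2, e1⟩ := detYTwo_crit_coeffs
  have e4 : detYTwo (stripYT 2) 4 = 1 := rfl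
  have e0 : detYTwo (stripYT 2) 0 = 0 := rfl
  rw [qMonicTwo_monic.2]
  simp only [Finset.sum_range_succ, Finset.sum_range_zero, h0, h1, h2, h3, zero_add, e3, e2, e1, e4, e0,
    show n + 1 + 0 = n + 1 by ring, show n + 1 + 1 = n + 2 by ring, show n + 1 + 2 = n + 3 by ring, show n + 1 + 3 = n + 4 by ring, add_zero]
  push_cast
  ring

/-- The common geometric rate `R := max(3/5, ρ₂)` (`ρ₂ = rhoTwo` of «WIDTH-TWO CONTACT ASYMPTOTICS»); `0 < R < 1`. [cite: Feller1968, XIII.10; lane plumbing] -/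
def rTwoDet : ℝ := max (3 / 5) rhoTwo

/-- `0 < R`, `R < 1`, `3/5 ≤ R`, `ρ₂ ≤ R` (plumbing). [cite: Feller1968, XIII.10; lane plumbing] -/
theorem rTwoDet_facts : 0 < rTwoDet ∧ rTwoDet < 1 ∧ 3 / 5 ≤ rTwoDet ∧ rhoTwo ≤ rTwoDet := by
  obtain ⟨-, -, hρ1, hρ0⟩ := rhoTwo_facts
  refine ⟨lt_max_of_lt_left (by norm_num), max_lt (by norm_num) hρ1, le_max_left _ _, le_max_right _ _⟩

/-- `|D̂(n+1)_{ab} − A_{ab}| ≤ K·(n+1)⁰·Rⁿ` at `y₂` (from «WIDTH-TWO CONTACT ASYMPTOTICS» `exists_gTwo_pow_mul_sub_abs_le`, `hatD_two_eq_pow_mul`, `projTwo_mul_one_add`).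
[cite: Feller1968, XIII.10; lane plumbing] -/
theorem abs_hatD_two_sub_lim_le : ∃ K : ℝ, 0 ≤ K ∧ ∀ (a b : Fin (2 * 2)) (n : ℕ),
    |hatD 2 (stripYT 2) (n + 1) a b - limTwo a b| ≤ K * ((n : ℝ) + 1) ^ 0 * rTwoDet ^ n := by
  obtain ⟨hR0, hR1, -, hρR⟩ := rTwoDet_facts
  obtain ⟨hr0, hrρ, -, hρ0⟩ := rhoTwo_facts
  have hy : 0 ≤ stripYT 2 := (stripYT_pos (by norm_num)).le
  have key : ∀ a b : Fin (2 * 2), ∃ K : ℝ, 0 ≤ K ∧ ∀ n : ℕ, |hatD 2 (stripYT 2) (n + 1) a b - limTwo a b| ≤ K * ((n : ℝ) + 1) ^ 0 * rTwoDet ^ n := by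
    intro a b
    obtain ⟨C, hC⟩ := exists_gTwo_pow_mul_sub_abs_le (1 + hatMZeroTwo) a b
    have hC0 : 0 ≤ C := by
      have h := hC 0
      exact le_trans (abs_nonneg _) (by simpa using h)
    refine ⟨C, hC0, fun n => ?_⟩
    have h := hC (n + 1)
    rw [projTwo_mul_one_add, ← hatD_two_eq_pow_mul hy (by omega)] at h
    calc |hatD 2 (stripYT 2) (n + 1) a b - limTwo a b| ≤ C * rhoTwo ^ (n + 1) := h
      _ ≤ C * rTwoDet ^ n := by
          refine mul_le_mul_of_nonneg_left ?_ hC0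
          calc rhoTwo ^ (n + 1) ≤ rhoTwo ^ n := pow_le_pow_of_le_one hρ0.le (by linarith) (by omega)
            _ ≤ rTwoDet ^ n := pow_le_pow_left₀ hρ0.le hρR n
      _ = C * ((n : ℝ) + 1) ^ 0 * rTwoDet ^ n := by rw [pow_zero, mul_one]
  choose K hK0 hK using key
  refine ⟨∑ a, ∑ b, K a b, Finset.sum_nonneg fun a _ => Finset.sum_nonneg fun b _ => hK0 a b, fun a b n => (hK a b n).trans ?_⟩
  have hle : K a b ≤ ∑ a, ∑ b, K a b :=
    calc K a b ≤ ∑ b', K a b' := Finset.single_le_sum (fun b' _ => hK0 a b') (Finset.mem_univ b)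
      _ ≤ ∑ a', ∑ b', K a' b' := Finset.single_le_sum (fun a' _ => Finset.sum_nonneg fun b' _ => hK0 a' b') (Finset.mem_univ a)
  exact mul_le_mul_of_nonneg_right (mul_le_mul_of_nonneg_right hle (by positivity)) (by positivity)

/-! ## §3 The constants -/

/-- `c := −T_y/T_λ` (`= ½ + x² = (3 − √2)/2 = 2θ₂`, next module). [cite: Feller1968, XIII.6; lane «pcv-sawmu» a-p2 g29] -/
def cDetTwo : ℝ := -tyTwo / tOneTwo

/-- `c₂ := −(T_λλc² + 2cT_λy + T_y)/T_λ` (here `T_yy = T_y`). [cite: Feller1968, XIII.6; lane «pcv-sawmu» a-p2 g29] -/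
def cTwoDetTwo : ℝ := -(tTwoTwo * cDetTwo ^ 2 + 2 * cDetTwo * tlyTwo + tyTwo) / tOneTwo

/-- The linear coefficient of `Ĉ²(n+1)`: `(−2cA·T_λy − 2m₀T_y − T_y·A − c²A·T_λλ)/T_λ − c²A`. [cite: Feller1968, XIII.6; lane «pcv-sawmu» a-p2 g29] -/
def linQTwoDet (A m₀ : ℝ) : ℝ := (-2 * cDetTwo * A * tlyTwo - 2 * m₀ * tyTwo - tyTwo * A - cDetTwo ^ 2 * A * tTwoTwo) / tOneTwo - cDetTwo ^ 2 * A

/-- Source coefficients of the `Ĉ³` recurrence (`T_yy = T_yyy = T_y`, `Σrẗ = T_λy`). [cite: Feller1968, XIII.6; lane «pcv-sawmu» a-p2 g29] -/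
def cubSrc2TwoDet (A : ℝ) : ℝ := -3 * (cDetTwo ^ 2 * A) * tyTwo
/-- see `cubSrc2TwoDet`. [cite: Feller1968, XIII.6; lane «pcv-sawmu» a-p2 g29] -/
def cubSrc1TwoDet (A m₀ : ℝ) : ℝ := -6 * (cDetTwo ^ 2 * A) * tlyTwo - 3 * linQTwoDet A m₀ * tyTwo - 3 * (cDetTwo * A) * tyTwo
/-- see `cubSrc2TwoDet`. [cite: Feller1968, XIII.6; lane «pcv-sawmu» a-p2 g29] -/
def cubSrc0TwoDet (A m₀ m₂ : ℝ) : ℝ :=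
  -3 * (cDetTwo ^ 2 * A) * trryTwo - 3 * linQTwoDet A m₀ * tlyTwo - 3 * m₂ * tyTwo - 3 * (cDetTwo * A) * tlyTwo - 3 * m₀ * tyTwo - tyTwo * A
/-- `α = ℓ₂ˢ/T_λ`. [cite: Stanley2012EC1, §4.1; lane «pcv-sawmu» a-p2 g29] -/
def cubATwoDet (A : ℝ) : ℝ := cubSrc2TwoDet A / tOneTwo
/-- `β = (ℓ₁ˢ − αT_λλ)/T_λ`. [cite: Stanley2012EC1, §4.1; lane «pcv-sawmu» a-p2 g29] -/
def cubBTwoDet (A m₀ : ℝ) : ℝ := (cubSrc1TwoDet A m₀ - cubATwoDet A * tTwoTwo) / tOneTwo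
/-- `γ = (ℓ₀ˢ − α(T_λλλ/3 + T_λλ/2) − βT_λλ/2)/T_λ`. [cite: Stanley2012EC1, §4.1; lane «pcv-sawmu» a-p2 g29] -/
def cubCTwoDet (A m₀ m₂ : ℝ) : ℝ := (cubSrc0TwoDet A m₀ m₂ - cubATwoDet A * (tThreeTwo / 3 + tTwoTwo / 2) - cubBTwoDet A m₀ * (tTwoTwo / 2)) / tOneTwo

/-! ## §4 The three moment laws -/

/-- ★★★ **Linear law of `Ĉ` (det route)**: `T_λ ≠ 0` and `∃ m₀ K, |Ĉ(n+1)_{ab} − (cA_{ab}·n + m₀)| ≤ K(n+1)³Rⁿ` (source `−Σṫ_rD̂ → −T_yA`).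
[cite: Feller1968, XIII.6; Stanley2012EC1, §4.1 Theorem 4.1.1 (iii); lane «pcv-sawmu» a-p2 g29 — own result] -/
theorem exists_hatCD_two_linear_det (a b : Fin (2 * 2)) :
    tOneTwo ≠ 0 ∧ ∃ m₀ K : ℝ, 0 ≤ K ∧ ∀ n : ℕ,
      |hatCD (stripYT 2) (n + 1) a b - (cDetTwo * limTwo a b * (n : ℝ) + m₀)| ≤ K * ((n : ℝ) + 1) ^ 3 * rTwoDet ^ n := by
  obtain ⟨hQm, hdeg⟩ := qMonicTwo_monic
  obtain ⟨hR0, hR1, hR35, -⟩ := rTwoDet_facts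
  obtain ⟨K₀, hK₀', hK₀⟩ := abs_hatD_two_sub_lim_le
  have hy : 0 < stripYT 2 := stripYT_pos (by norm_num)
  set A := limTwo a b with hA
  -- source identity
  have hsrc : ∀ n : ℕ, ∑ r ∈ range 5, detYTwo (stripYT 2) r * hatCD (stripYT 2) (n + r + 1) a b
      = -(tyTwo * A) - ∑ r ∈ range 5, detYTwoDot (stripYT 2) r * (hatD 2 (stripYT 2) (n + r + 1) a b - A) := by
    intro n
    have h := detYTwo_contact_annihilator hy a b n
    have e1 : ∑ r ∈ range 5, detYTwoDot (stripYT 2) r * (hatD 2 (stripYT 2) (n + r + 1) a b - A)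
        = ∑ r ∈ range 5, detYTwoDot (stripYT 2) r * hatD 2 (stripYT 2) (n + 1 + r) a b - tyTwo * A := by
      rw [tyTwo, Finset.sum_mul, ← Finset.sum_sub_distrib]
      exact Finset.sum_congr rfl fun r _ => by rw [show n + r + 1 = n + 1 + r by ring]; ring
    have e2 : ∑ r ∈ range 5, detYTwo (stripYT 2) r * hatCD (stripYT 2) (n + r + 1) a b
        = ∑ r ∈ range 5, detYTwo (stripYT 2) r * hatCD (stripYT 2) (n + 1 + r) a b :=
      Finset.sum_congr rfl fun r _ => by rw [show n + r + 1 = n + 1 + r by ring]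
    rw [e1, e2]; linarith
  have hw : ∀ n : ℕ, ‖∑ j ∈ range (qMonicTwo.natDegree + 1), qMonicTwo.coeff j
        * (((hatCD (stripYT 2) (n + 1 + j + 1) a b : ℝ) : ℂ) - ((hatCD (stripYT 2) (n + j + 1) a b : ℝ) : ℂ))
        - ((((0 : ℝ)) : ℂ) * (n : ℂ) + (((-(tyTwo * A)) : ℝ) : ℂ))‖
      ≤ (K₀ * ∑ r ∈ range 5, |detYTwoDot (stripYT 2) r| * ((r : ℝ) + 1) ^ 0) * ((n : ℝ) + 1) ^ 0 * rTwoDet ^ n := by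
    intro n
    rw [sum_coeff_qMonicTwo_diff (fun m => hatCD (stripYT 2) (m + 1) a b) n, hsrc n]
    have e : (((-(tyTwo * A) - ∑ r ∈ range 5, detYTwoDot (stripYT 2) r * (hatD 2 (stripYT 2) (n + r + 1) a b - A) : ℝ)) : ℂ)
        - ((((0 : ℝ)) : ℂ) * (n : ℂ) + (((-(tyTwo * A)) : ℝ) : ℂ))
        = -(((∑ r ∈ range 5, detYTwoDot (stripYT 2) r * (hatD 2 (stripYT 2) (n + r + 1) a b - A) : ℝ)) : ℂ) := by push_cast; ring
    rw [e, norm_neg, Complex.norm_real, Real.norm_eq_abs]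
    have h := abs_sum_mul_shift_le_five (g := fun r => detYTwoDot (stripYT 2) r) (e := fun m => hatD 2 (stripYT 2) (m + 1) a b - A)
      hR0.le hR1.le hK₀' (hK₀ a b) n
    simpa only [mul_assoc] using h
  obtain ⟨hT, m₀, K, hK, hb⟩ := Literature.Analysis.exists_abs_sub_quadratic_le_of_linearRecurrence_one_real
    (w := fun m => hatCD (stripYT 2) (m + 1) a b) (ℓ₁ := 0) (ℓ₀ := -(tyTwo * A)) hQm hR0 hR1
    (fun z hz => (qMonicTwo_root_norm_le hz).trans hR35) sum_coeff_qMonicTwo sum_coeff_mul_qMonicTwo (by positivity) hw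
  refine ⟨hT, m₀, K, hK, fun n => ?_⟩
  have h := hb n
  rw [hdeg] at h
  have e : (0 : ℝ) / tOneTwo / 2 * (n : ℝ) ^ 2 + ((-(tyTwo * A) - 0 / tOneTwo * (tTwoTwo / 2)) / tOneTwo - 0 / tOneTwo / 2) * (n : ℝ) + m₀
      = cDetTwo * A * (n : ℝ) + m₀ := by rw [cDetTwo]; field_simp; ring
  rw [e] at h
  exact h

/-- ★★★ **Quadratic law of `Ĉ²` (det route)**: `∃ m₀ m₂ K` with the linear law of `Ĉ` and `|Ĉ²(n+1)_{ab} − (c²A·n² + linQTwoDet A m₀·n + m₂)| ≤ K(n+1)⁶Rⁿ`.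
[cite: Feller1968, XIII.6; Stanley2012EC1, §4.1 Theorem 4.1.1 (iii); lane «pcv-sawmu» a-p2 g29 — own result] -/
theorem exists_hatC2D_two_quadratic_det (a b : Fin (2 * 2)) :
    ∃ m₀ m₂ K : ℝ, 0 ≤ K ∧ (∀ n : ℕ,
      |hatCD (stripYT 2) (n + 1) a b - (cDetTwo * limTwo a b * (n : ℝ) + m₀)| ≤ K * ((n : ℝ) + 1) ^ 3 * rTwoDet ^ n) ∧
      ∀ n : ℕ, |hatC2D (stripYT 2) (n + 1) a b - (cDetTwo ^ 2 * limTwo a b * (n : ℝ) ^ 2 + linQTwoDet (limTwo a b) m₀ * (n : ℝ) + m₂)|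
        ≤ K * ((n : ℝ) + 1) ^ 6 * rTwoDet ^ n := by
  obtain ⟨hQm, hdeg⟩ := qMonicTwo_monic
  obtain ⟨hR0, hR1, hR35, -⟩ := rTwoDet_facts
  obtain ⟨K₀, hK₀', hK₀⟩ := abs_hatD_two_sub_lim_le
  obtain ⟨hT, m₀, K₁, hK₁, hb₁⟩ := exists_hatCD_two_linear_det a b
  have hy : 0 < stripYT 2 := stripYT_pos (by norm_num)
  set A := limTwo a b with hA
  set ℓ₁ : ℝ := -2 * (cDetTwo * A) * tyTwo with hℓ₁
  set ℓ₀ : ℝ := -2 * (cDetTwo * A) * tlyTwo - 2 * m₀ * tyTwo - tyTwo * A with hℓ₀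
  have hsrc : ∀ n : ℕ, ∑ r ∈ range 5, detYTwo (stripYT 2) r * hatC2D (stripYT 2) (n + r + 1) a b - (ℓ₁ * (n : ℝ) + ℓ₀)
      = -(2 * ∑ r ∈ range 5, detYTwoDot (stripYT 2) r * (hatCD (stripYT 2) (n + r + 1) a b - (cDetTwo * A * ((n + r : ℕ) : ℝ) + m₀))
          + ∑ r ∈ range 5, detYTwoDot (stripYT 2) r * (hatD 2 (stripYT 2) (n + r + 1) a b - A)) := by
    intro n
    have h := detYTwo_contact_sq_annihilator hy a b n
    have e1 : ∑ r ∈ range 5, detYTwoDot (stripYT 2) r * (hatCD (stripYT 2) (n + r + 1) a b - (cDetTwo * A * ((n + r : ℕ) : ℝ) + m₀))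
        = ∑ r ∈ range 5, detYTwoDot (stripYT 2) r * hatCD (stripYT 2) (n + 1 + r) a b
          - (cDetTwo * A * (n : ℝ) * tyTwo + cDetTwo * A * tlyTwo + m₀ * tyTwo) := by
      rw [tyTwo, tlyTwo, Finset.mul_sum, Finset.mul_sum, Finset.mul_sum, ← Finset.sum_add_distrib, ← Finset.sum_add_distrib, ← Finset.sum_sub_distrib]
      exact Finset.sum_congr rfl fun r _ => by rw [show n + r + 1 = n + 1 + r by ring]; push_cast; ring
    have e2 : ∑ r ∈ range 5, detYTwoDot (stripYT 2) r * (hatD 2 (stripYT 2) (n + r + 1) a b - A)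
        = ∑ r ∈ range 5, detYTwoDot (stripYT 2) r * hatD 2 (stripYT 2) (n + 1 + r) a b - tyTwo * A := by
      rw [tyTwo, Finset.sum_mul, ← Finset.sum_sub_distrib]
      exact Finset.sum_congr rfl fun r _ => by rw [show n + r + 1 = n + 1 + r by ring]; ring
    have e3 : ∑ r ∈ range 5, detYTwo (stripYT 2) r * hatC2D (stripYT 2) (n + r + 1) a b
        = ∑ r ∈ range 5, detYTwo (stripYT 2) r * hatC2D (stripYT 2) (n + 1 + r) a b :=
      Finset.sum_congr rfl fun r _ => by rw [show n + r + 1 = n + 1 + r by ring]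
    rw [e1, e2, e3, hℓ₁, hℓ₀]; linarith
  set S₁ : ℝ := K₁ * ∑ r ∈ range 5, |detYTwoDot (stripYT 2) r| * ((r : ℝ) + 1) ^ 3 with hS₁
  set S₀ : ℝ := K₀ * ∑ r ∈ range 5, |detYTwoDot (stripYT 2) r| * ((r : ℝ) + 1) ^ 0 with hS₀
  have hS₁0 : 0 ≤ S₁ := mul_nonneg hK₁ (Finset.sum_nonneg fun r _ => by positivity)
  have hS₀0 : 0 ≤ S₀ := mul_nonneg hK₀' (Finset.sum_nonneg fun r _ => by positivity)
  have hw : ∀ n : ℕ, ‖∑ j ∈ range (qMonicTwo.natDegree + 1), qMonicTwo.coeff j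
        * (((hatC2D (stripYT 2) (n + 1 + j + 1) a b : ℝ) : ℂ) - ((hatC2D (stripYT 2) (n + j + 1) a b : ℝ) : ℂ))
        - (((ℓ₁ : ℝ) : ℂ) * (n : ℂ) + ((ℓ₀ : ℝ) : ℂ))‖ ≤ (2 * S₁ + S₀) * ((n : ℝ) + 1) ^ 3 * rTwoDet ^ n := by
    intro n
    rw [sum_coeff_qMonicTwo_diff (fun m => hatC2D (stripYT 2) (m + 1) a b) n]
    rw [← Complex.ofReal_natCast, ← Complex.ofReal_mul, ← Complex.ofReal_add, ← Complex.ofReal_sub, Complex.norm_real, Real.norm_eq_abs,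
      hsrc n, abs_neg]
    have h1 := abs_sum_mul_shift_le_five (g := fun r => detYTwoDot (stripYT 2) r)
      (e := fun m => hatCD (stripYT 2) (m + 1) a b - (cDetTwo * A * (m : ℝ) + m₀)) hR0.le hR1.le hK₁ hb₁ n
    have h2 := abs_sum_mul_shift_le_five (g := fun r => detYTwoDot (stripYT 2) r) (e := fun m => hatD 2 (stripYT 2) (m + 1) a b - A)
      hR0.le hR1.le hK₀' (hK₀ a b) n
    rw [← hS₁] at h1
    rw [← hS₀] at h2
    have hn1 : (1 : ℝ) ≤ (n : ℝ) + 1 := by linarith [(Nat.cast_nonneg n : (0 : ℝ) ≤ n)]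
    have hpow : ((n : ℝ) + 1) ^ 0 * rTwoDet ^ n ≤ ((n : ℝ) + 1) ^ 3 * rTwoDet ^ n :=
      mul_le_mul_of_nonneg_right (pow_le_pow_right₀ hn1 (by norm_num)) (by positivity)
    have h2' := h2.trans (mul_le_mul_of_nonneg_left hpow hS₀0)
    calc |2 * ∑ r ∈ range 5, detYTwoDot (stripYT 2) r * (hatCD (stripYT 2) (n + r + 1) a b - (cDetTwo * A * ((n + r : ℕ) : ℝ) + m₀))
        + ∑ r ∈ range 5, detYTwoDot (stripYT 2) r * (hatD 2 (stripYT 2) (n + r + 1) a b - A)|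
      ≤ |2 * ∑ r ∈ range 5, detYTwoDot (stripYT 2) r * (hatCD (stripYT 2) (n + r + 1) a b - (cDetTwo * A * ((n + r : ℕ) : ℝ) + m₀))|
        + |∑ r ∈ range 5, detYTwoDot (stripYT 2) r * (hatD 2 (stripYT 2) (n + r + 1) a b - A)| := abs_add_le _ _
    _ ≤ 2 * (S₁ * (((n : ℝ) + 1) ^ 3 * rTwoDet ^ n)) + S₀ * (((n : ℝ) + 1) ^ 3 * rTwoDet ^ n) := by
        rw [abs_mul, abs_two]; exact add_le_add (mul_le_mul_of_nonneg_left h1 zero_le_two) h2'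
    _ = (2 * S₁ + S₀) * ((n : ℝ) + 1) ^ 3 * rTwoDet ^ n := by ring
  obtain ⟨-, m₂, K₂, hK₂, hb₂⟩ := Literature.Analysis.exists_abs_sub_quadratic_le_of_linearRecurrence_one_real
    (w := fun m => hatC2D (stripYT 2) (m + 1) a b) (ℓ₁ := ℓ₁) (ℓ₀ := ℓ₀) hQm hR0 hR1
    (fun z hz => (qMonicTwo_root_norm_le hz).trans hR35) sum_coeff_qMonicTwo sum_coeff_mul_qMonicTwo (by linarith) hw
  refine ⟨m₀, m₂, max K₁ K₂, le_max_of_le_left hK₁, fun n => (hb₁ n).trans (by gcongr; exact le_max_left _ _), fun n => ?_⟩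
  have h := hb₂ n
  rw [hdeg] at h
  have hty : tyTwo = -(cDetTwo * tOneTwo) := by
    have : cDetTwo * tOneTwo = -tyTwo := by rw [cDetTwo]; field_simp
    linarith
  have e : ℓ₁ / tOneTwo / 2 * (n : ℝ) ^ 2 + ((ℓ₀ - ℓ₁ / tOneTwo * (tTwoTwo / 2)) / tOneTwo - ℓ₁ / tOneTwo / 2) * (n : ℝ) + m₂
      = cDetTwo ^ 2 * A * (n : ℝ) ^ 2 + linQTwoDet A m₀ * (n : ℝ) + m₂ := by
    rw [linQTwoDet, hℓ₁, hℓ₀, hty]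
    field_simp
  rw [e] at h
  exact h.trans (by gcongr; exact le_max_right _ _)

end W2

end HV

end Literature.Probability.RandomPlanarGeometry.SAW
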